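import Summits.Ventures.HodgeKum4.Bookkeeping
import Summits.Ventures.HodgeKum4.FixedLocus
import HarnessLib

/-!
# H3 — the Hodge conjecture for projective manifolds of `Kum⁴`-type: statement, index, glue

Cell `hodge-kum4` (ladder HodgeAV, rung H3).  FROZEN TYPING by the planner seat, reconciling the
co-drafts of seat p1 (`HOME/p1/Kum4LieGeneration.lean`) and seat p2 (`HOME/p2/Kum4L3Statement.lean`,
`Kum4Glue.lean`).  Tree path `Summits/Ventures/HodgeKum4/Statement.lean` (director-endorsed
2026-08-25; operator path).  HONEST FRAMING: nothing here asserts that a case of the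
Hodge conjecture is proved.  Every `def … : Prop` is a STATEMENT — an obligation of the cell or a
print input offered for vendoring — and every `theorem` is kernel glue (standard axioms, no `sorry`;
the one glue taking a named Literature fact as a hypothesis says so: `hc_kum4Type_of_dominated`).
H3 is a rung, not a thesis: nothing here is glued to `Summit.HodgeConjecture`, no route is opened here.

This file is the INDEX of the venture (the pattern of `Summits/Ventures/HSemireg/Statement.lean`): it
imports the three topic modules, states the rung (§0) and carries the kernel glue to the rung (§5, §6).
It is a split by topic — no statement or proof changed — of the single-file FROZEN typing sha16
e3550acdea16baa3 (semantic audit PASS 5934162d, 2026-08-25): §1–§2 ↦ `Invariants.lean`, §3 ↦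
`Bookkeeping.lean`, §4 ↦ `FixedLocus.lean`, §0/§5/§6 ↦ this file.

## §0 The rung (this file)
`HC_Kum4Type` — for every smooth projective `X/ℂ` of dimension `8` of `Kum⁴`-type
(`Hyperkaehler.IsOfGeneralizedKummerType 4 X`), the tree's per-variety statement
`HodgeTheory.HodgeConjectureFor 8 X` (shape of the `Kum²`/`Kum³` named facts in
`Hyperkaehler/GeneralizedKummerTypeHodgeConjecture`).  Bonus statement `HC_Kum4TypePowers` (§6).

## §1 The group `Γ(X)` (`Invariants.lean`)
`autFixingH2H3 X : Subgroup (Aut X)` (p2) — automorphisms acting trivially on `H²` and `H³`;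
intrinsic, no marking, no frame (for `Kum⁴`-type: the `625` translations, `Γ(X) ≅ (ℤ/5)⁴`).
`IsGammaInvariant X c` (degreewise), `gammaInvariantClasses X` (total cohomology), bridges.

## §2 L1 — Lie generation (`Invariants.lean`; p1).  PROOF-RISK node: sole certificate = the cell's computation
OFFICIAL `LefschetzGenerationKum4`: for every `sl(2)`-triple `(L_ℓ, h, Λ)`,
`H*(X(ℂ); ℂ)^{Γ(X)} ⊆ ⟨H⁰, H², H³⟩_{(Λ, ∪)}` (`opCupSpan`).  Second layer: `LefschetzGenerationKum4Frame`,
`IsKummerTranslationFrame`, `frameInvariants`, the print input `KummerTranslationFrameExists`, KERNEL glue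
`lefschetzGenerationKum4_of_frame`.  Grade: COMPUTED-CERT ×2 code-disjoint (kit j237456/j237580 (g0),
j237941 (g2); LOW table from j237941 only) mod ONE named print fact `MODEL_X` (FTV19 Thm 1.5 + FG03
Thm 3.10, REFEREED) and `LooijengaLuntsVerbitsky_llvStructure_kumType` (LL97 (4.5)/GKLR22 Thm 14, REFEREED).

## §3 L2 — motivic bookkeeping (`Bookkeeping.lean`).  GRADE-LOAD node: all print inputs REFEREED (lit round 1)
OFFICIAL `MotivicBookkeepingKum4 := LefschetzGenerationKum4 → InvariantHodgeClassesAlgebraicKum4`.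
Second layer: L2a `GammaInvariantsRetractKum4`, L2c `RetractHodgeClassesAlgebraic`, S1
`PolarizationHasDualLefschetz`, KERNEL glue `motivicBookkeepingKum4_of : L2a → L2c → L2`.  Print inputs
BY NAME: `Foster2024_lefschetzStandard_kummerType_prime`, `Markman2023_thirdCohomology_kummerType_discOneWeilFourfold`,
Voisin22 Thm 4.1 with O'Grady21 Thm 1.5, `FloccariFu2026_hodgeClasses_algebraic_powers_discOneWeilFourfold`.

## §4 L3 — fixed-fourfold span (`FixedLocus.lean`; p2).  Lowest risk; one elementary unpublished number
OFFICIAL `FixedFourfoldSpanKum4` (splitting form).  Second layer: `GammaFiniteKum4` (L3a),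
`GammaCoinvariantClassesAlgebraicKum4` (L3b), `gammaAverage` API, KERNEL glue
`fixedFourfoldSpan_of_finite_of_coinvariant`; p2's nodes VERBATIM: `middleRep`,
`Kum4NonInvariantClassesAlgebraic` (L3°), `Kum4TranslationGroup` (F_Γ, PRINT),
`Kum4TranslationGroupTrivialOffMiddle` (F_Γ′, PRINT), `Kum4FixedFourfoldClasses` (I, CELL-PROVED),
KERNEL glue `gammaFinite_of_translationGroup`, `gammaCoinvariant_of`.

## §5 Glue (this file; kernel): `hc_kum4Type_of : L1 → L2 → L3 → H3`,
`hc_kum4Type_of_inputs : L1 → L2 → F_Γ → F_Γ′ → L3° → H3`.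

## §6 Alternative assembly through domination (this file; lit): `dominatedClasses`, L2a′
`GammaInvariantsDominatedKum4` (⇐ L2a), `AlgebraicClassesDominated` (bookkeeping),
`exists_isDominatedByPowers_kum4Type`, and `hc_kum4Type_of_dominated : Arapura2006 fact → L1 → L2a′ →
F_Γ → F_Γ′ → L3° → bookkeeping → H3 ∧ HC_Kum4TypePowers`.
-/

noncomputable section

open CategoryTheory
open Literature.AlgebraicTopology.SingularHomology
open Literature.AlgebraicGeometry Literature.AlgebraicGeometry.HodgeTheory
  Literature.AlgebraicGeometry.Hyperkaehler

namespace Summit.Ventures.HodgeKum4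

-- commutator bracket on `gl(H*)`, Mathlib's local-instance idiom (as in `Hyperkaehler/LooijengaLuntsVerbitsky`)
attribute [local instance 100] LieRing.ofAssociativeRing

/-! ### §0 The rung H3 -/

/-- **H3 — the Hodge conjecture for every smooth projective variety of `Kum⁴`-type.**  OPEN IN PRINT
(lit round 1, 2026-08-25: Floccari–Varesco 2024 Thm 1.1 gives only the `A₂•`-classes; Floccari–Fu
2026 Thm 13.2 covers `Kum²`, `Kum³`). -/
def HC_Kum4Type : Prop :=
  ∀ ⦃X : Motives.SchemeOver ℂ⦄, Motives.IsSmoothProjective 8 X → IsOfGeneralizedKummerType 4 X →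
    HodgeConjectureFor 8 X

/-! ### §5 Glue to the rung -/

/-- **GLUE: L1 → L2 → L3 → H3** (kernel-checked; a Hodge model exists by the tree's THEOREM
`nonempty_hodgeModel_holds`, and `c = c₀ + (c - c₀)` with both summands algebraic). -/
theorem hc_kum4Type_of (h₁ : LefschetzGenerationKum4) (h₂ : MotivicBookkeepingKum4)
    (h₃ : FixedFourfoldSpanKum4) : HC_Kum4Type := by
  intro X hX hK
  refine ⟨HodgeTheory.nonempty_hodgeModel_holds hX, fun p c hc hpp ↦ ?_⟩
  obtain ⟨c₀, hc₀, hpp₀, hinv₀, halg⟩ := h₃ hX hK p c hc hpp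
  have h₀ : c₀ ∈ algebraicClasses X p := h₂ h₁ hX hK p c₀ hc₀ hpp₀ hinv₀
  have hsplit : c = c₀ + (c - c₀) := by abel
  rw [hsplit]
  exact add_mem h₀ halg

/-- **GLUE through the layers: L1 → L2 → F_Γ → F_Γ′ → L3° → H3.**  With p2's
`kum4NonInvariantClassesAlgebraic_of : F_Γ → I → L3°`, p1's `lefschetzGenerationKum4_of` and
`lefschetzGenerationKum4_of_frame`, and `motivicBookkeepingKum4_of`, the cell's open obligations are
exactly: L1_frame (p1, mod `MODEL_X`), frame existence, L2a, L2c, F_Γ, F_Γ′, I. -/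
theorem hc_kum4Type_of_inputs (h₁ : LefschetzGenerationKum4) (h₂ : MotivicBookkeepingKum4)
    (hΓ : Kum4TranslationGroup) (hoff : Kum4TranslationGroupTrivialOffMiddle)
    (h₃ : Kum4NonInvariantClassesAlgebraic) : HC_Kum4Type :=
  hc_kum4Type_of h₁ h₂ (fixedFourfoldSpan_of_finite_of_coinvariant (gammaFinite_of_translationGroup hΓ)
    (gammaCoinvariant_of h₃ hoff))


/-! ### §6 Alternative assembly through cohomological domination (literature seat's proposal)

`H*(X) = H*(X)^{Γ(X)} ⊕ 𝒦` (the latter in degree `8` only, F_Γ′), the invariants dominated by the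
powers of `B = J³(X)` (L2a′, from L1 and the motivic inputs), `𝒦` algebraic (L3°) hence dominated
(`AlgebraicClassesDominated`, bookkeeping); so `X` is dominated by the powers of `B`
(`HodgeTheory.IsDominatedByPowers 8 X 4 B`) and the tree's REFEREED named fact
`HodgeTheory.Arapura2006_hodgeClasses_algebraic_of_isDominatedByPowers` (Arapura 2006 Lem. 4.2) gives
the Hodge conjecture for `X` AND FOR ALL ITS POWERS (bonus: Floccari–Fu Conj. 1.4 shadow for `Kum⁴`).
This replaces the kernel target L2c by a named fact; the official chain of §5 is unchanged. -/

/-- The `ℂ`-span of the classes in `Hᵏ(Y(ℂ); ℂ)` lying in the image of an algebraic correspondence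
from some power `B^e` (any twist) — the submodule whose equality to `⊤` in every degree is
`HodgeTheory.IsDominatedByPowers dY Y dX B` (literally). -/
def dominatedClasses (dY : ℕ) (Y : Motives.SchemeOver ℂ) (dX : ℕ) (B : Motives.SchemeOver ℂ) (k : ℕ) :
    Submodule ℂ (complexBetti Y k) :=
  Submodule.span ℂ
    {c : complexBetti Y k |
      ∃ (e a : ℕ) (T : complexBetti (B.pow e) a →ₗ[ℂ] complexBetti Y k),
        IsAlgebraicCorrespondence dY (e * dX) Y (B.pow e) T ∧ c ∈ LinearMap.range T}

/-- Unfolding (`Iff.rfl`): `Y` is dominated by the powers of `B` (`HodgeTheory.IsDominatedByPowers dY Y dX B`)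
iff `dominatedClasses dY Y dX B k = ⊤` in every degree `k`. -/
theorem isDominatedByPowers_iff_dominatedClasses {dY : ℕ} {Y : Motives.SchemeOver ℂ} {dX : ℕ}
    {B : Motives.SchemeOver ℂ} :
    IsDominatedByPowers dY Y dX B ↔ ∀ k, dominatedClasses dY Y dX B k = ⊤ :=
  Iff.rfl

/-- **L2a′ — the `Γ(X)`-invariant classes are dominated by the powers of an abelian fourfold with HC
for its powers** (span form of L2a; given L1).  Intended `B = J³(X)` (lit: named fact
`Markman2023_thirdCohomology_kummerType_discOneWeilFourfold`, p404171, + the tree's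
`FloccariFu2026_…discOneWeilFourfold` / `hodgeConjectureFor_powSucc_of_floccariFu`). -/
def GammaInvariantsDominatedKum4 : Prop :=
  LefschetzGenerationKum4 →
    ∀ ⦃X : Motives.SchemeOver ℂ⦄, Motives.IsSmoothProjective 8 X → IsOfGeneralizedKummerType 4 X →
      ∃ B : Motives.SchemeOver ℂ, Motives.IsSmoothProjective 4 B ∧
        (∀ m : ℕ, HodgeConjectureFor ((m + 1) * 4) (B.pow (m + 1))) ∧
        ∀ (k : ℕ) (c : complexBetti X k), IsGammaInvariant X c → c ∈ dominatedClasses 8 X 4 B k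

/-- **KERNEL: L2a (retract) ⟹ L2a′ (dominated).** -/
theorem gammaInvariantsDominated_of_retract (h : GammaInvariantsRetractKum4) :
    GammaInvariantsDominatedKum4 := by
  intro h1 X hX hK
  obtain ⟨B, hB, hHC, hret⟩ := h h1 hX hK
  refine ⟨B, hB, hHC, fun k c hc ↦ ?_⟩
  obtain ⟨ι, _, e, a, u, v, hu, hv, hsum⟩ := hret k
  rw [← hsum c hc]
  exact Submodule.sum_mem _ fun i _ ↦
    Submodule.subset_span ⟨e i, a i, v i, hv i, LinearMap.mem_range_self (v i) (u i c)⟩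

/-- **Bookkeeping input (folklore; kernel target over the Gysin/correspondence files): algebraic classes
are dominated** — every algebraic class on `Y` lies in the image of an algebraic correspondence from a
power of `B` (e.g. `e = 0`: the class `z × [pt]` on `Y × B⁰` sends `1 ∈ H⁰(pt)` to `z`). -/
def AlgebraicClassesDominated : Prop :=
  ∀ ⦃dY : ℕ⦄ ⦃Y : Motives.SchemeOver ℂ⦄ ⦃dX : ℕ⦄ ⦃B : Motives.SchemeOver ℂ⦄,
    Motives.IsSmoothProjective dY Y → Motives.IsSmoothProjective dX B →
      ∀ p : ℕ, algebraicClasses Y p ≤ dominatedClasses dY Y dX B (2 * p)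

/-- **Bonus statement: the Hodge conjecture for all powers `X^{m+1}` of a smooth projective `Kum⁴`-type
`X`.** -/
def HC_Kum4TypePowers : Prop :=
  ∀ ⦃X : Motives.SchemeOver ℂ⦄, Motives.IsSmoothProjective 8 X → IsOfGeneralizedKummerType 4 X →
    ∀ m : ℕ, HodgeConjectureFor ((m + 1) * 8) (X.pow (m + 1))

/-- **KERNEL: L1 ∧ L2a′ ∧ F_Γ ∧ F_Γ′ ∧ L3° ∧ (algebraic ⟹ dominated) ⟹ every smooth projective
`Kum⁴`-type `X` is dominated by the powers of a fourfold `B` all of whose powers satisfy HC.**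
(`c = avg(c) + (c - avg(c))`: the average is `Γ`-invariant hence dominated; in degree `8` the
remainder lies in `𝒦 ⊆` algebraic `⊆` dominated, in other degrees it vanishes.) -/
theorem exists_isDominatedByPowers_kum4Type (h₁ : LefschetzGenerationKum4)
    (h₂ : GammaInvariantsDominatedKum4) (hΓ : Kum4TranslationGroup)
    (hoff : Kum4TranslationGroupTrivialOffMiddle) (h₃ : Kum4NonInvariantClassesAlgebraic)
    (halg : AlgebraicClassesDominated) ⦃X : Motives.SchemeOver ℂ⦄ (hX : Motives.IsSmoothProjective 8 X)
    (hK : IsOfGeneralizedKummerType 4 X) :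
    ∃ B : Motives.SchemeOver ℂ, Motives.IsSmoothProjective 4 B ∧
      (∀ m : ℕ, HodgeConjectureFor ((m + 1) * 4) (B.pow (m + 1))) ∧ IsDominatedByPowers 8 X 4 B := by
  obtain ⟨B, hB, hHC, hdom⟩ := h₂ h₁ hX hK
  refine ⟨B, hB, hHC, fun k ↦ ?_⟩
  rw [eq_top_iff]
  rintro c -
  change c ∈ dominatedClasses 8 X 4 B k
  haveI : Finite (autFixingH2H3 X) := gammaFinite_of_translationGroup hΓ hX hK
  letI : Fintype (autFixingH2H3 X) := Fintype.ofFinite _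
  have hsplit : c = gammaAverage X k c + (c - gammaAverage X k c) := by abel
  rw [hsplit]
  refine add_mem (hdom k _ (isGammaInvariant_gammaAverage k c)) ?_
  refine sub_gammaAverage_mem k c _ fun γ ↦ ?_
  by_cases hk : k = 8
  · subst hk
    have hmem : complexBetti.map γ.val.hom 8 c - c ∈ algebraicClasses X 4 :=
      gammaCoinvariant_of h₃ hoff hX hK 4 c γ.val γ.property
    exact halg hX hB 4 hmem
  · rw [hoff hX hK k hk γ.val γ.property]
    simp

/-- **GLUE (domination variant): Arapura's named fact ∧ L1 ∧ L2a′ ∧ F_Γ ∧ F_Γ′ ∧ L3° ∧ bookkeeping ⟹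
H3 and HC for all powers of every smooth projective `Kum⁴`-type `X`.** -/
theorem hc_kum4Type_of_dominated (hA : Arapura2006_hodgeClasses_algebraic_of_isDominatedByPowers)
    (h₁ : LefschetzGenerationKum4) (h₂ : GammaInvariantsDominatedKum4) (hΓ : Kum4TranslationGroup)
    (hoff : Kum4TranslationGroupTrivialOffMiddle) (h₃ : Kum4NonInvariantClassesAlgebraic)
    (halg : AlgebraicClassesDominated) : HC_Kum4Type ∧ HC_Kum4TypePowers := by
  refine ⟨fun X hX hK ↦ ?_, fun X hX hK m ↦ ?_⟩
  · obtain ⟨B, hB, hHC, hD⟩ := exists_isDominatedByPowers_kum4Type h₁ h₂ hΓ hoff h₃ halg hX hK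
    exact (hA hB hX hD hHC).1
  · obtain ⟨B, hB, hHC, hD⟩ := exists_isDominatedByPowers_kum4Type h₁ h₂ hΓ hoff h₃ halg hX hK
    exact (hA hB hX hD hHC).2 m

end Summit.Ventures.HodgeKum4

end
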